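import Literature.MathematicalPhysics.QuantumFieldTheory.Balaban1983to89.T4DobrushinTensorisation
import HarnessLib

/-!
# Robust ball (Y2), strong-coupling laws — an INVERSE Efron–Stein inequality: a variance FLOOR from orthogonal one-site fluctuations

HONEST FRAMING: venture file of the cell `pub-ymgap` (QuantumFields programme), track ROBUST-BALL, seat rb-p2 (g8).  This file is
GENERIC finite-dimensional probability (a finite product `Π i, E i` of measurable spaces, a law `Q`, single-site resampling kernels
`qᵢ`), written on the `resample` / `ResamplingInvariant` / `gibbsKernel` / `gibbsMeasure` interface of the tree's
`Balaban1983to89.T4DobrushinTensorisation`; it is the engine of the energy-variance floor of the torus Wilson state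
(`EnergyVarianceTorus.lean`) and of the strong convexity of the lattice Yang–Mills free energy (`FreeEnergyStrongConvexity.lean`).
Nothing here is about the continuum, a spectral gap or the Clay problem.

THE INEQUALITY (`sum_dirichlet_le_variance`).  Let `Q` be resampling-invariant for local Markov kernels `qᵢ` (`qᵢ` is a version
of the conditional law of the `i`-th coordinate and does not read it), `f` bounded measurable, and `F` a finite set of sites such
that for `i ≠ i'` in `F`: (sep) `f` is additively separable in the coordinates `i, i'`
(`f(ξ^{i'←y, i←z}) − f(ξ^{i←z})` does not depend on `z`) and (loc) `qᵢ` does not read the coordinate `i'`.  Then the one-site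
fluctuations `Xᵢ = f − Πᵢ f` (`Πᵢ f ξ = ∫ f(ξ^{i←y}) dqᵢ(ξ)(y)`), `i ∈ F`, are CENTRED and PAIRWISE ORTHOGONAL in `L²(Q)`, each
with `‖Xᵢ‖² = ⟨f, Xᵢ⟩ = ∫ f (f − Πᵢ f) dQ` (the one-site Dirichlet form), so Bessel's inequality gives

  `Var_Q(f) = ∫ (f − ∫ f dQ)² dQ ≥ ∑_{i ∈ F} ∫ f (f − Πᵢ f) dQ`

— the REVERSE of the Efron–Stein direction (`Var ≤ ∑ᵢ` over ALL sites for a product law), valid for the sites of an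
"interaction-independent" set.  For the one-site GIBBS kernels of a bounded measurable energy `A` (`gibbsKernel π A`, a priori
probability laws `πᵢ`) with one-site oscillation `≤ δ` at `i`, the Dirichlet form is bounded below by `e^{−δ}` times the
`Q`-mean of the a-priori fibre variance `∫ Var_{πᵢ}(y ↦ f(ξ^{i←y})) dQ(ξ)` (`dirichlet_ge_exp_neg_mul_fibreVariance`), the kernel
at `i` does not read a coordinate `j` in which `A` is separable from `i` (`gibbsKernel_update_of_separable`), and resampling a
site from its a-priori law costs at most `e^{−δ}` on the mean of a non-negative observable (`exp_neg_mul_integral_resample_le`).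
The Gibbs-kernel statements and the packaged form for the Gibbs law `Q = gibbsMeasure π A`
(`sum_fibreVariance_le_variance_gibbs`) are in the sequel `EnergyVarianceGibbsFloor.lean`; this file is Part A (abstract kernels).

References (statement type only; everything here is proved from Mathlib and the tree): B. Efron, C. Stein, Ann. Statist. 9
(1981) 586 (the upper bound this inverts); H.-O. Georgii, *Gibbs Measures and Phase Transitions* (2011), Remark 1.24 (DLR
identities at single sites). [folklore]
-/

noncomputable section

open MeasureTheory ProbabilityTheory Finset Function
open Literature.MathematicalPhysics.QuantumFieldTheory.Balaban1983to89.T4DobrushinTensorisation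
open Literature.MathematicalPhysics.QuantumFieldTheory.Balaban1983to89.T4CouplingChain (integrable_of_abs_le_const)

namespace Summit.Ventures.YMGap.RobustBall

namespace EnergyVariance

universe u v

variable {ι : Type u} [Fintype ι] [DecidableEq ι] {E : ι → Type v} [∀ i, MeasurableSpace (E i)]

/-! ### Part A — one-site fluctuations: centring, self-duality, orthogonality, Bessel -/

section Bessel

variable {q : (i : ι) → Kernel ((j : ι) → E j) (E i)} [∀ i, IsMarkovKernel (q i)]
variable {Q : Measure ((j : ι) → E j)} [IsProbabilityMeasure Q]

omit [Fintype ι] in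
/-- The resampling operator fixes constants (Markov kernels). [folklore] -/
theorem resample_const (i : ι) (c : ℝ) (ξ : (j : ι) → E j) : resample q i (fun _ => c) ξ = c := by
  simp [resample_apply]

omit [Fintype ι] in
/-- The resampled fluctuation vanishes on every fibre: `∫ (f − Πᵢ f)(ξ^{i←y}) dqᵢ(ξ)(y) = 0` (locality of `qᵢ`). [folklore] -/
theorem integral_fluct_update_eq_zero
    (hloc : ∀ (i : ι) (ξ : (j : ι) → E j) (y : E i), q i (update ξ i y) = q i ξ) (i : ι)
    {f : ((j : ι) → E j) → ℝ} {B : ℝ} (hfm : Measurable f) (hB : ∀ ξ, |f ξ| ≤ B) (ξ : (j : ι) → E j) :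
    ∫ y, (f (update ξ i y) - resample q i f (update ξ i y)) ∂(q i ξ) = 0 := by
  have hi1 : Integrable (fun y => f (update ξ i y)) (q i ξ) :=
    integrable_of_abs_le_const (hfm.comp (measurable_update _)).stronglyMeasurable fun y => hB _
  simp_rw [resample_update hloc]
  rw [integral_sub hi1 (integrable_const _), integral_const, smul_eq_mul, probReal_univ, one_mul, resample_apply,
    sub_self]

omit [Fintype ι] [∀ i, IsMarkovKernel (q i)] [IsProbabilityMeasure Q] in
/-- The fluctuation `f − Πᵢ f` is `Q`-centred (resampling invariance). [folklore] -/
theorem integral_fluct_eq_zero [∀ i, IsMarkovKernel (q i)] [IsProbabilityMeasure Q] (hinv : ResamplingInvariant Q q) (i : ι)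
    {f : ((j : ι) → E j) → ℝ} {B : ℝ} (hfm : Measurable f) (hB : ∀ ξ, |f ξ| ≤ B) :
    ∫ ξ, (f ξ - resample q i f ξ) ∂Q = 0 := by
  have hif : Integrable f Q := integrable_of_abs_le_const hfm.stronglyMeasurable hB
  have hir : Integrable (resample q i f) Q :=
    integrable_of_abs_le_const (measurable_resample i hfm).stronglyMeasurable (abs_resample_le i hB)
  rw [integral_sub hif hir, integral_resample_eq hinv i hfm hB, sub_self]

omit [Fintype ι] in
/-- **Self-duality of the one-site Dirichlet form**: `∫ (f − Πᵢ f)² dQ = ∫ f (f − Πᵢ f) dQ`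
(`∫ Πᵢ f · (f − Πᵢ f) dQ = 0` by the one-site symmetry `∫ f Πᵢ f = ∫ (Πᵢ f)²`). [folklore] -/
theorem integral_fluct_sq_eq
    (hloc : ∀ (i : ι) (ξ : (j : ι) → E j) (y : E i), q i (update ξ i y) = q i ξ)
    (hinv : ResamplingInvariant Q q) (i : ι)
    {f : ((j : ι) → E j) → ℝ} {B : ℝ} (hfm : Measurable f) (hB : ∀ ξ, |f ξ| ≤ B) :
    ∫ ξ, (f ξ - resample q i f ξ) ^ 2 ∂Q = ∫ ξ, f ξ * (f ξ - resample q i f ξ) ∂Q := by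
  have hrm : Measurable (resample q i f) := measurable_resample i hfm
  have hrb : ∀ ξ, |resample q i f ξ| ≤ B := abs_resample_le i hB
  have hsymm := integral_mul_resample_symm hloc hinv i hfm hB hfm hB
  have hi1 : Integrable (fun ξ => f ξ * resample q i f ξ) Q :=
    integrable_of_abs_le_const (hfm.mul hrm).stronglyMeasurable (R := B * B) fun ξ => by
      rw [abs_mul]; exact mul_le_mul (hB ξ) (hrb ξ) (abs_nonneg _) ((abs_nonneg _).trans (hB ξ))
  have hi2 : Integrable (fun ξ => resample q i f ξ * resample q i f ξ) Q :=
    integrable_of_abs_le_const (hrm.mul hrm).stronglyMeasurable (R := B * B) fun ξ => by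
      rw [abs_mul]; exact mul_le_mul (hrb ξ) (hrb ξ) (abs_nonneg _) ((abs_nonneg _).trans (hB ξ))
  have hi3 : Integrable (fun ξ => f ξ * (f ξ - resample q i f ξ)) Q :=
    integrable_of_abs_le_const (hfm.mul (hfm.sub hrm)).stronglyMeasurable (R := B * (B + B)) fun ξ => by
      rw [abs_mul]
      exact mul_le_mul (hB ξ) ((abs_sub _ _).trans (add_le_add (hB ξ) (hrb ξ))) (abs_nonneg _)
        ((abs_nonneg _).trans (hB ξ))
  have hi12 : Integrable (fun ξ => f ξ * resample q i f ξ - resample q i f ξ * resample q i f ξ) Q := hi1.sub hi2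
  have hsplit : ∀ ξ, (f ξ - resample q i f ξ) ^ 2 =
      f ξ * (f ξ - resample q i f ξ) - (f ξ * resample q i f ξ - resample q i f ξ * resample q i f ξ) := fun ξ => by ring
  simp_rw [hsplit]
  rw [integral_sub hi3 hi12, integral_sub hi1 hi2, hsymm, sub_self, sub_zero]

omit [Fintype ι] [IsProbabilityMeasure Q] in
/-- **Orthogonality of one-site fluctuations at separated sites.**  If `f` is additively separable in the coordinates `i ≠ i'`
and `qᵢ` does not read the coordinate `i'`, then `∫ (f − Πᵢ f)(f − Π_{i'} f) dQ = 0`. [folklore] -/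
theorem integral_fluct_mul_fluct_eq_zero
    (hloc : ∀ (i : ι) (ξ : (j : ι) → E j) (y : E i), q i (update ξ i y) = q i ξ)
    (hinv : ResamplingInvariant Q q) {i i' : ι}
    {f : ((j : ι) → E j) → ℝ} {B : ℝ} (hfm : Measurable f) (hB : ∀ ξ, |f ξ| ≤ B)
    (hsep : ∀ (ξ : (j : ι) → E j) (y : E i') (z : E i),
      f (update (update ξ i' y) i z) - f (update ξ i z) = f (update ξ i' y) - f ξ)
    (hq : ∀ (ξ : (j : ι) → E j) (y : E i'), q i (update ξ i' y) = q i ξ) :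
    ∫ ξ, (f ξ - resample q i f ξ) * (f ξ - resample q i' f ξ) ∂Q = 0 := by
  -- the fluctuation at `i` does not read the coordinate `i'`
  have hX : ∀ (ξ : (j : ι) → E j) (y : E i'),
      f (update ξ i' y) - resample q i f (update ξ i' y) = f ξ - resample q i f ξ := by
    intro ξ y
    have hi1 : Integrable (fun z => f (update ξ i z)) (q i ξ) :=
      integrable_of_abs_le_const (hfm.comp (measurable_update _)).stronglyMeasurable fun z => hB _
    rw [resample_apply, resample_apply, hq ξ y]
    have h1 : ∀ z, f (update (update ξ i' y) i z) = f (update ξ i z) + (f (update ξ i' y) - f ξ) := fun z => by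
      have := hsep ξ y z; linarith
    simp_rw [h1]
    rw [integral_add hi1 (integrable_const _), integral_const, smul_eq_mul, probReal_univ, one_mul]
    ring
  have hm1 : Measurable fun ξ => f ξ - resample q i f ξ := hfm.sub (measurable_resample i hfm)
  have hm2 : Measurable fun ξ => f ξ - resample q i' f ξ := hfm.sub (measurable_resample i' hfm)
  have hb1 : ∀ ξ, |f ξ - resample q i f ξ| ≤ B + B := fun ξ =>
    (abs_sub _ _).trans (add_le_add (hB ξ) (abs_resample_le i hB ξ))
  have hb2 : ∀ ξ, |f ξ - resample q i' f ξ| ≤ B + B := fun ξ =>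
    (abs_sub _ _).trans (add_le_add (hB ξ) (abs_resample_le i' hB ξ))
  have hF := hinv i' (fun ξ => (f ξ - resample q i f ξ) * (f ξ - resample q i' f ξ)) ((B + B) * (B + B))
    (hm1.mul hm2) (fun ξ => by
      rw [abs_mul]
      exact mul_le_mul (hb1 ξ) (hb2 ξ) (abs_nonneg _) ((abs_nonneg _).trans (hb1 ξ)))
  rw [← hF]
  refine integral_eq_zero_of_ae (Filter.Eventually.of_forall fun ξ => ?_)
  simp only [hX]
  rw [integral_const_mul, integral_fluct_update_eq_zero hloc i' hfm hB ξ, mul_zero]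
  rfl

omit [Fintype ι] in
/-- ★★ **The inverse Efron–Stein inequality (Bessel for orthogonal one-site fluctuations).**  Let `Q` be resampling-invariant for
the local Markov kernels `qᵢ`, `f` bounded measurable, and `F` a finite set of sites such that for all `i ≠ i'` in `F` the
observable `f` is additively separable in the coordinates `i, i'` and `qᵢ` does not read the coordinate `i'`.  Then

  `∑_{i ∈ F} ∫ f (f − Πᵢ f) dQ ≤ ∫ (f − ∫ f dQ)² dQ = Var_Q(f)`.

Proof: the `Xᵢ = f − Πᵢ f`, `i ∈ F`, are centred, pairwise orthogonal, `‖Xᵢ‖² = ⟨f − c, Xᵢ⟩ = Dᵢ`, and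
`0 ≤ ‖(f − c) − ∑ᵢ Xᵢ‖² = Var − 2 ∑ Dᵢ + ∑ Dᵢ`. [folklore] -/
theorem sum_dirichlet_le_variance
    (hloc : ∀ (i : ι) (ξ : (j : ι) → E j) (y : E i), q i (update ξ i y) = q i ξ)
    (hinv : ResamplingInvariant Q q) {f : ((j : ι) → E j) → ℝ} {B : ℝ} (hfm : Measurable f) (hB : ∀ ξ, |f ξ| ≤ B)
    (F : Finset ι)
    (hsep : ∀ i ∈ F, ∀ i' ∈ F, i ≠ i' → ∀ (ξ : (j : ι) → E j) (y : E i') (z : E i),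
      f (update (update ξ i' y) i z) - f (update ξ i z) = f (update ξ i' y) - f ξ)
    (hq : ∀ i ∈ F, ∀ i' ∈ F, i ≠ i' → ∀ (ξ : (j : ι) → E j) (y : E i'), q i (update ξ i' y) = q i ξ) :
    ∑ i ∈ F, ∫ ξ, f ξ * (f ξ - resample q i f ξ) ∂Q ≤ ∫ ξ, (f ξ - ∫ ζ, f ζ ∂Q) ^ 2 ∂Q := by
  have hB0 : ∀ ξ : (j : ι) → E j, 0 ≤ B := fun ξ => (abs_nonneg _).trans (hB ξ)
  set c : ℝ := ∫ ζ, f ζ ∂Q with hc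
  -- the fluctuations and their bounds
  set X : ι → ((j : ι) → E j) → ℝ := fun i ξ => f ξ - resample q i f ξ with hXdef
  have hXm : ∀ i, Measurable (X i) := fun i => hfm.sub (measurable_resample i hfm)
  have hXb : ∀ i ξ, |X i ξ| ≤ B + B := fun i ξ =>
    (abs_sub _ _).trans (add_le_add (hB ξ) (abs_resample_le i hB ξ))
  have hcb : |c| ≤ B := abs_integral_le_of_abs_le Q hB
  -- Dirichlet forms
  set D : ι → ℝ := fun i => ∫ ξ, f ξ * X i ξ ∂Q with hD
  -- integrability facts
  have hif : Integrable f Q := integrable_of_abs_le_const hfm.stronglyMeasurable hB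
  have hig : Integrable (fun ξ => f ξ - c) Q := hif.sub (integrable_const _)
  have hiX : ∀ i, Integrable (X i) Q := fun i =>
    integrable_of_abs_le_const (hXm i).stronglyMeasurable (hXb i)
  have hifX : ∀ i, Integrable (fun ξ => f ξ * X i ξ) Q := fun i =>
    integrable_of_abs_le_const (hfm.mul (hXm i)).stronglyMeasurable (R := B * (B + B)) fun ξ => by
      rw [abs_mul]; exact mul_le_mul (hB ξ) (hXb i ξ) (abs_nonneg _) (hB0 ξ)
  have hiXX : ∀ i i', Integrable (fun ξ => X i ξ * X i' ξ) Q := fun i i' =>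
    integrable_of_abs_le_const ((hXm i).mul (hXm i')).stronglyMeasurable (R := (B + B) * (B + B)) fun ξ => by
      rw [abs_mul]
      have := hB0 ξ
      exact mul_le_mul (hXb i ξ) (hXb i' ξ) (abs_nonneg _) (by positivity)
  -- (1) `⟨f − c, Xᵢ⟩ = Dᵢ` (centring)
  have h1 : ∀ i ∈ F, ∫ ξ, (f ξ - c) * X i ξ ∂Q = D i := by
    intro i _
    have hsplit : ∀ ξ, (f ξ - c) * X i ξ = f ξ * X i ξ - c * X i ξ := fun ξ => by ring
    simp_rw [hsplit]
    rw [integral_sub (hifX i) ((hiX i).const_mul c), integral_const_mul]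
    have h0 : ∫ ξ, X i ξ ∂Q = 0 := integral_fluct_eq_zero hinv i hfm hB
    rw [h0, mul_zero, sub_zero]
  -- (2) the Gram matrix of the fluctuations is diagonal with entries `Dᵢ`
  have h2 : ∀ i ∈ F, ∀ i' ∈ F, ∫ ξ, X i ξ * X i' ξ ∂Q = if i = i' then D i' else 0 := by
    intro i hi i' hi'
    split_ifs with h
    · subst h
      have hsq : ∀ ξ, X i ξ * X i ξ = (f ξ - resample q i f ξ) ^ 2 := fun ξ => by rw [hXdef]; ring
      simp_rw [hsq]
      exact integral_fluct_sq_eq hloc hinv i hfm hB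
    · exact integral_fluct_mul_fluct_eq_zero hloc hinv hfm hB (hsep i hi i' hi' h) (hq i hi i' hi' h)
  -- (3) Bessel: expand `0 ≤ ∫ ((f − c) − ∑_{i∈F} Xᵢ)² dQ`
  have hiS : Integrable (fun ξ => ∑ i ∈ F, X i ξ) Q := integrable_finsetSum _ fun i _ => hiX i
  have hSm : Measurable fun ξ => ∑ i ∈ F, X i ξ := Finset.measurable_sum _ fun i _ => hXm i
  have hSb : ∀ ξ, |∑ i ∈ F, X i ξ| ≤ ∑ _i ∈ F, (B + B) := fun ξ =>
    (Finset.abs_sum_le_sum_abs _ _).trans (Finset.sum_le_sum fun i _ => hXb i ξ)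
  have higS : Integrable (fun ξ => (f ξ - c) * ∑ i ∈ F, X i ξ) Q :=
    integrable_of_abs_le_const ((hfm.sub measurable_const).mul hSm).stronglyMeasurable
      (R := (B + B) * ∑ _i ∈ F, (B + B)) fun ξ => by
        rw [abs_mul]
        have := hB0 ξ
        exact mul_le_mul ((abs_sub _ _).trans (add_le_add (hB ξ) hcb)) (hSb ξ) (abs_nonneg _) (by positivity)
  have hiSS : Integrable (fun ξ => (∑ i ∈ F, X i ξ) * ∑ i ∈ F, X i ξ) Q :=
    integrable_of_abs_le_const (hSm.mul hSm).stronglyMeasurable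
      (R := (∑ _i ∈ F, (B + B)) * ∑ _i ∈ F, (B + B)) fun ξ => by
        rw [abs_mul]
        have := hB0 ξ
        exact mul_le_mul (hSb ξ) (hSb ξ) (abs_nonneg _) (by positivity)
  have higg : Integrable (fun ξ => (f ξ - c) ^ 2) Q :=
    integrable_of_abs_le_const ((hfm.sub measurable_const).pow_const 2).stronglyMeasurable
      (R := (B + B) ^ 2) fun ξ => by
        rw [abs_pow]; exact pow_le_pow_left₀ (abs_nonneg _) ((abs_sub _ _).trans (add_le_add (hB ξ) hcb)) 2
  -- cross term
  have hcross : ∫ ξ, (f ξ - c) * ∑ i ∈ F, X i ξ ∂Q = ∑ i ∈ F, D i := by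
    simp_rw [Finset.mul_sum]
    rw [integral_finsetSum _ fun i _ => ?_]
    · exact Finset.sum_congr rfl h1
    · exact integrable_of_abs_le_const ((hfm.sub measurable_const).mul (hXm i)).stronglyMeasurable
        (R := (B + B) * (B + B)) fun ξ => by
          rw [abs_mul]
          have := hB0 ξ
          exact mul_le_mul ((abs_sub _ _).trans (add_le_add (hB ξ) hcb)) (hXb i ξ) (abs_nonneg _) (by positivity)
  -- square term
  have hsquare : ∫ ξ, (∑ i ∈ F, X i ξ) * ∑ i ∈ F, X i ξ ∂Q = ∑ i ∈ F, D i := by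
    simp_rw [Finset.sum_mul_sum]
    rw [integral_finsetSum _ fun i _ => integrable_finsetSum _ fun i' _ => hiXX i i']
    have hin : ∀ i ∈ F, ∫ ξ, ∑ i' ∈ F, X i ξ * X i' ξ ∂Q = D i := by
      intro i hi
      rw [integral_finsetSum _ fun i' _ => hiXX i i']
      rw [Finset.sum_congr rfl fun i' hi' => h2 i hi i' hi', Finset.sum_ite_eq F i D, if_pos hi]
    exact Finset.sum_congr rfl hin
  have hexp : ∀ ξ, ((f ξ - c) - ∑ i ∈ F, X i ξ) ^ 2 =
      (f ξ - c) ^ 2 - 2 * ((f ξ - c) * ∑ i ∈ F, X i ξ) + (∑ i ∈ F, X i ξ) * ∑ i ∈ F, X i ξ := fun ξ => by ring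
  have hnonneg : 0 ≤ ∫ ξ, ((f ξ - c) - ∑ i ∈ F, X i ξ) ^ 2 ∂Q := integral_nonneg fun ξ => sq_nonneg _
  simp_rw [hexp] at hnonneg
  have higS2 : Integrable (fun ξ => 2 * ((f ξ - c) * ∑ i ∈ F, X i ξ)) Q := higS.const_mul 2
  have hiA : Integrable (fun ξ => (f ξ - c) ^ 2 - 2 * ((f ξ - c) * ∑ i ∈ F, X i ξ)) Q := higg.sub higS2
  rw [integral_add hiA hiSS, integral_sub higg higS2, integral_const_mul, hcross, hsquare] at hnonneg
  have hfin : ∑ i ∈ F, ∫ ξ, f ξ * (f ξ - resample q i f ξ) ∂Q = ∑ i ∈ F, D i := rfl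
  rw [hfin]
  linarith

omit [Fintype ι] in
/-- The same floor for the Mathlib variance `Var[f; Q]`. [folklore] -/
theorem sum_dirichlet_le_variance'
    (hloc : ∀ (i : ι) (ξ : (j : ι) → E j) (y : E i), q i (update ξ i y) = q i ξ)
    (hinv : ResamplingInvariant Q q) {f : ((j : ι) → E j) → ℝ} {B : ℝ} (hfm : Measurable f) (hB : ∀ ξ, |f ξ| ≤ B)
    (F : Finset ι)
    (hsep : ∀ i ∈ F, ∀ i' ∈ F, i ≠ i' → ∀ (ξ : (j : ι) → E j) (y : E i') (z : E i),
      f (update (update ξ i' y) i z) - f (update ξ i z) = f (update ξ i' y) - f ξ)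
    (hq : ∀ i ∈ F, ∀ i' ∈ F, i ≠ i' → ∀ (ξ : (j : ι) → E j) (y : E i'), q i (update ξ i' y) = q i ξ) :
    ∑ i ∈ F, ∫ ξ, f ξ * (f ξ - resample q i f ξ) ∂Q ≤ Var[f; Q] := by
  rw [variance_eq_integral hfm.aemeasurable]
  exact sum_dirichlet_le_variance hloc hinv hfm hB F hsep hq

end Bessel

end EnergyVariance

end Summit.Ventures.YMGap.RobustBall
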